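import Literature.Analysis.FluidPDE.PeriodicWeightedPoincare
import Literature.Analysis.FluidPDE.NashLogIntegralInequality
import Literature.Analysis.FluidPDE.LeiZhang2011Proofs
import HarnessLib

/-!
# Lei–Ren–Zhang 2019, (3.9): the Nash–Poincaré lower bound per period

Analysis/FluidPDE proofs file (theorems only, no definitions, no named facts), on the discharge
path of the named fact `Literature.Analysis.FluidPDE.leiRenZhang2019_liouville_periodic`
(Z. Lei, X. Ren, Q. S. Zhang, arXiv:1902.11229 = Math. Ann. 383 (2022), Theorem 1.1). Proof of
Lemma 3.1, (3.9) (arXiv p. 7): "By Nash's inequality (see Lemma 3.2 below) and the weighted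
Poincaré inequality (3.6), and since `Ψ = −ln Φ`,
`|ln(∫_{D_R}Φdμ) + ∫_{D_R}Ψdμ|²(∫_{D_R}Φdμ)² ≤ |sup Φ|²∫_{D_R}|Ψ − Ψ̄|²dμ ≤ C₃∫_{D_R}|∇Ψ|²ζ_R²dx`"
for the probability measure `dμ = ζ_R² dx / ∫_{D_R} ζ_R²` on one period, and its use on the set
`W` of (3.11)–(3.12): the periodic twin of the tree's `LeiZhang2011.nash_poincare_lower`, with the
whole-space integrals replaced by slab integrals over `zSlab P 0`, the radial cut-off by the
cylindrical one, and (3.4) of Lei–Zhang by (3.6) (`setIntegral_sub_average_sq_mul_cylCutoff_sq_le`).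

* `nash_poincare_lower_periodic` — for `0 < P ≤ ρ`, `ζ = cylCutoff (ρ/2) ρ`, `Z = ∫_{slab} ζ²`,
  a periodic slice `F ∈ C¹` with `ε ≤ F ≤ 3` on `{r ≤ ρ}`, `H = −log` on `[ε/2, ∞)`, and numbers
  `w₀ > 0`, `L₀ ≥ max(0, −ln w₀)`: if `∫_{slab} Fζ² ≥ w₀Z` and `Y = ∫_{slab} H(F)ζ² ≥ 2L₀Z`, then
  `w₀² Y²/(36864 ρ² Z) ≤ ∫_{slab} H'(F)²‖∇F‖²ζ²`.

## References

* Z. Lei, X. Ren, Q. S. Zhang, arXiv:1902.11229, §3, proof of Lemma 3.1, (3.9) and Lemma 3.2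
  (arXiv pp. 7–8). [LeiRenZhang2019]
* Z. Lei, Q. S. Zhang, arXiv:1011.5066, proof of Lemma 3.2 (p. 10) (tree
  `LeiZhang2011.nash_poincare_lower`). [LeiZhang2011]
-/

noncomputable section

open MeasureTheory Set Function Filter Metric
open _root_.Topology
open scoped InnerProductSpace RealInnerProductSpace NNReal ENNReal

namespace Literature.Analysis.FluidPDE

namespace LeiRenZhang2019

/-- **The Nash–Poincaré lower bound for the good term, per period** (Lei–Ren–Zhang 2019, proof
of Lemma 3.1, (3.9) and its use on `W`). For `0 < P ≤ ρ`, `ε > 0`, `ζ = cylCutoff (ρ/2) ρ`,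
`Z = ∫_{zSlab P 0} ζ²`, an axially `P`-periodic slice `F ∈ C¹` with `ε ≤ F ≤ 3` on `{r ≤ ρ}`,
`H ∈ C¹` with `H = −log` on `[ε/2, ∞)`, and numbers `w₀ > 0`, `L₀ ≥ max(0, −ln w₀)`: if
`∫_{slab} F ζ² ≥ w₀ Z` and `Y = ∫_{slab} H(F) ζ² ≥ 2 L₀ Z`, then
`w₀² Y² / (36864 ρ² Z) ≤ ∫_{slab} H'(F)² ‖∇F‖² ζ²` (Nash's inequality
`abs_log_integral_sub_integral_log_le` for the probability measure `ζ²dx/Z` on the slab,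
`f = F` clamped to `[ε, 3]`, `M = 3`; then the weighted Poincaré inequality per period for
`Ψ = H∘F`; `ln(∫Fζ²/Z) + Y/Z ≥ Y/(2Z) ≥ 0`). [cite: LeiRenZhang2019, §3, proof of Lemma 3.1, (3.9) (arXiv p. 7), Nash inequality step] -/
theorem nash_poincare_lower_periodic {P ρ ε : ℝ} (hP : 0 < P) (hPρ : P ≤ ρ) (hε : 0 < ε)
    {F : EuclideanSpace ℝ (Fin 3) → ℝ} (hF : ContDiff ℝ 1 F) (hFp : IsAxiallyPeriodic P F)
    (hFb : ∀ x, cylRadius x ≤ ρ → ε ≤ F x ∧ F x ≤ 3)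
    {H : ℝ → ℝ} (hH : ContDiff ℝ 1 H) (hHeq : ∀ v, ε / 2 ≤ v → H v = -Real.log v)
    {w₀ L₀ : ℝ} (hw₀ : 0 < w₀) (hL₀0 : 0 ≤ L₀) (hL₀ : -Real.log w₀ ≤ L₀)
    (hmass : w₀ * ∫ y in zSlab P 0, cylCutoff (ρ / 2) ρ y ^ 2 ≤
      ∫ x in zSlab P 0, F x * cylCutoff (ρ / 2) ρ x ^ 2)
    (hY : 2 * L₀ * ∫ y in zSlab P 0, cylCutoff (ρ / 2) ρ y ^ 2 ≤
      ∫ x in zSlab P 0, H (F x) * cylCutoff (ρ / 2) ρ x ^ 2) :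
    w₀ ^ 2 / (36864 * ρ ^ 2 * ∫ y in zSlab P 0, cylCutoff (ρ / 2) ρ y ^ 2) *
        (∫ x in zSlab P 0, H (F x) * cylCutoff (ρ / 2) ρ x ^ 2) ^ 2 ≤
      ∫ x in zSlab P 0, deriv H (F x) ^ 2 * ‖gradient F x‖ ^ 2 * cylCutoff (ρ / 2) ρ x ^ 2 := by
  have hρ : 0 < ρ := hP.trans_le hPρ
  have hΨp : IsAxiallyPeriodic P (H ∘ F) := fun x => congrArg H (hFp x)
  obtain ⟨hZpos, hPW⟩ := setIntegral_sub_average_sq_mul_cylCutoff_sq_le hP hPρ (hH.comp hF) hΨp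
  set φ : EuclideanSpace ℝ (Fin 3) → ℝ := cylCutoff (ρ / 2) ρ with hφdef
  set μs : Measure (EuclideanSpace ℝ (Fin 3)) := volume.restrict (zSlab P 0) with hμs
  set Z : ℝ := ∫ y in zSlab P 0, φ y ^ 2 with hZ
  set Y : ℝ := ∫ x in zSlab P 0, H (F x) * φ x ^ 2 with hYdef
  set G : ℝ := ∫ x in zSlab P 0, deriv H (F x) ^ 2 * ‖gradient F x‖ ^ 2 * φ x ^ 2 with hG
  have hρ2 : 0 ≤ ρ / 2 := by positivity
  have hρρ : ρ / 2 < ρ := half_lt_self hρ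
  have hφc : Continuous φ := (contDiff_cylCutoff (ρ / 2) ρ (n := 0)).continuous
  have hφ0 : ∀ x, 0 ≤ φ x := fun x => cylCutoff_nonneg _ _ _
  have hφK : ∀ x, ¬cylRadius x ≤ ρ → φ x = 0 := fun x hx =>
    cylCutoff_eq_zero hρ2 hρρ (le_of_lt (not_le.1 hx))
  -- the weighted mean of `Ψ = H∘F` is `Y/Z`; Poincaré in terms of `G`
  set m : ℝ := Y / Z with hm
  have hgradΨ : ∀ x, ‖gradient (H ∘ F) x‖ ^ 2 = deriv H (F x) ^ 2 * ‖gradient F x‖ ^ 2 := by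
    intro x
    have h := gradient_comp_apply ((hH.differentiable one_ne_zero) (F x)) ((hF.differentiable one_ne_zero) x)
    rw [show (H ∘ F) = fun y => H (F y) from rfl, h, norm_smul, mul_pow, Real.norm_eq_abs, sq_abs]
  have hPG : ∫ x in zSlab P 0, (H (F x) - m) ^ 2 * φ x ^ 2 ≤ 1024 * ρ ^ 2 * G := by
    have e1 : (∫ y in zSlab P 0, (H ∘ F) y * φ y ^ 2) / Z = m := by rw [hm, hYdef]; rfl
    have e2 : ∫ x in zSlab P 0, ‖gradient (H ∘ F) x‖ ^ 2 * φ x ^ 2 = G := by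
      rw [hG]
      refine integral_congr_ae (ae_of_all _ fun x => ?_)
      dsimp only
      rw [hgradΨ x]
    rw [e1, e2] at hPW
    exact hPW
  -- the clamped slice `f = max ε (min F 3)`: `0 < f ≤ 3`, `f = F` where `φ ≠ 0`
  have hε3 : ε ≤ 3 := by
    have h := hFb 0 (by
      have : cylRadius (0 : EuclideanSpace ℝ (Fin 3)) = 0 := by simp [cylRadius]
      rw [this]; exact hρ.le)
    exact h.1.trans h.2
  set f : EuclideanSpace ℝ (Fin 3) → ℝ := fun x => max ε (min (F x) 3) with hfdef
  have hf0 : ∀ x, 0 < f x := fun x => hε.trans_le (le_max_left _ _)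
  have hfε : ∀ x, ε ≤ f x := fun x => le_max_left _ _
  have hf3 : ∀ x, f x ≤ 3 := fun x => max_le hε3 (min_le_right _ _)
  have hfF : ∀ x, φ x ≠ 0 → f x = F x := by
    intro x hx
    have hxK : cylRadius x ≤ ρ := by by_contra h; exact hx (hφK x h)
    obtain ⟨h1, h2⟩ := hFb x hxK
    simp only [hfdef, min_eq_left h2, max_eq_right h1]
  have hfc : Continuous f := continuous_const.max (hF.continuous.min continuous_const)
  have hlogc : Continuous fun x => Real.log (f x) := hfc.log fun x => (hf0 x).ne'
  -- pointwise identities against `φ²`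
  have hfφ : ∀ x, φ x ^ 2 * f x = F x * φ x ^ 2 := by
    intro x
    by_cases hx : φ x = 0
    · rw [hx]; ring
    · rw [hfF x hx]; ring
  have hlogφ : ∀ x, φ x ^ 2 * Real.log (f x) = -(H (F x) * φ x ^ 2) := by
    intro x
    by_cases hx : φ x = 0
    · rw [hx]; ring
    · have hxK : cylRadius x ≤ ρ := by by_contra h; exact hx (hφK x h)
      have hv : ε / 2 ≤ F x := (half_le_self hε.le).trans (hFb x hxK).1
      rw [hfF x hx, hHeq _ hv]; ring
  -- the probability measure `φ² dx / Z` on the slab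
  set ω : EuclideanSpace ℝ (Fin 3) → ℝ≥0∞ := fun x => ENNReal.ofReal (φ x ^ 2) with hωdef
  have hωm : Measurable ω := ENNReal.measurable_ofReal.comp (hφc.pow 2).measurable
  have hωtop : ∀ᵐ x ∂μs, ω x < ∞ := ae_of_all _ fun x => ENNReal.ofReal_lt_top
  have hωtoReal : ∀ x, (ω x).toReal = φ x ^ 2 := fun x => ENNReal.toReal_ofReal (sq_nonneg _)
  have hφ2c : Continuous fun x => φ x ^ 2 := hφc.pow 2
  have hφ2i : Integrable (fun x => φ x ^ 2) μs :=
    integrableOn_zSlab_of_eq_zero_of_le_cylRadius hφ2c (ρ := ρ)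
      (fun x hx => by simp [cylCutoff_eq_zero hρ2 hρρ hx, hφdef]) P 0
  have hlintω : ∫⁻ x, ω x ∂μs = ENNReal.ofReal Z := by
    rw [hZ, ofReal_integral_eq_lintegral_ofReal hφ2i (ae_of_all _ fun x => sq_nonneg _)]
  set ν : Measure (EuclideanSpace ℝ (Fin 3)) := μs.withDensity ω with hν
  have hνuniv : ν univ = ENNReal.ofReal Z := by
    rw [hν, withDensity_apply _ MeasurableSet.univ, Measure.restrict_univ, hlintω]
  have hZne : ENNReal.ofReal Z ≠ 0 := (ENNReal.ofReal_pos.2 hZpos).ne'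
  set μ : Measure (EuclideanSpace ℝ (Fin 3)) := (ENNReal.ofReal Z)⁻¹ • ν with hμ
  haveI hprob : IsProbabilityMeasure μ := ⟨by
    rw [hμ, Measure.smul_apply, hνuniv, smul_eq_mul, ENNReal.inv_mul_cancel hZne ENNReal.ofReal_ne_top]⟩
  have hμint : ∀ g : EuclideanSpace ℝ (Fin 3) → ℝ, ∫ x, g x ∂μ = Z⁻¹ * ∫ x in zSlab P 0, φ x ^ 2 * g x := by
    intro g
    rw [hμ, integral_smul_measure, hν, integral_withDensity_eq_integral_toReal_smul hωm hωtop,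
      ENNReal.toReal_inv, ENNReal.toReal_ofReal hZpos.le, smul_eq_mul]
    congr 1
    refine integral_congr_ae (ae_of_all _ fun x => ?_)
    dsimp only
    rw [hωtoReal x, smul_eq_mul]
  -- the three integrals of Nash's inequality
  have hq : ∫ x, f x ∂μ = Z⁻¹ * ∫ x in zSlab P 0, F x * φ x ^ 2 := by
    rw [hμint]; congr 1
    exact integral_congr_ae (ae_of_all _ fun x => hfφ x)
  have hlogint : ∫ x, Real.log (f x) ∂μ = -(Y / Z) := by
    rw [hμint, integral_congr_ae (ae_of_all _ fun x => hlogφ x), integral_neg, hYdef]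
    field_simp
  have hvar : ∫ x, (Real.log (f x) - ∫ y, Real.log (f y) ∂μ) ^ 2 ∂μ =
      Z⁻¹ * ∫ x in zSlab P 0, (H (F x) - m) ^ 2 * φ x ^ 2 := by
    rw [hlogint, hμint]
    congr 1
    refine integral_congr_ae (ae_of_all _ fun x => ?_)
    dsimp only
    by_cases hx : φ x = 0
    · simp only [hx]; ring
    · have hxK : cylRadius x ≤ ρ := by by_contra h; exact hx (hφK x h)
      have hv : ε / 2 ≤ F x := (half_le_self hε.le).trans (hFb x hxK).1
      rw [hfF x hx, hHeq _ hv, hm]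
      ring
  -- Nash's inequality
  have hlogm : MemLp (fun x => Real.log (f x)) 2 μ := by
    refine (memLp_top_of_bound hlogc.aestronglyMeasurable (max |Real.log ε| |Real.log 3|)
      (ae_of_all _ fun x => ?_)).mono_exponent le_top
    rw [Real.norm_eq_abs, abs_le]
    constructor
    · have h1 : Real.log ε ≤ Real.log (f x) := Real.log_le_log hε (hfε x)
      have h2 : -max |Real.log ε| |Real.log 3| ≤ Real.log ε :=
        (neg_le_neg (le_max_left _ _)).trans (neg_abs_le _)
      linarith
    · have h1 : Real.log (f x) ≤ Real.log 3 := Real.log_le_log (hf0 x) (hf3 x)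
      exact h1.trans ((le_abs_self _).trans (le_max_right _ _))
  have hN := abs_log_integral_sub_integral_log_le (μ := μ) hf0 hf3 hlogm
  rw [hvar, hlogint, hq] at hN
  -- the numbers
  set q : ℝ := Z⁻¹ * ∫ x in zSlab P 0, F x * φ x ^ 2 with hqdef
  have hqw : w₀ ≤ q := by
    rw [hqdef, inv_mul_eq_div, le_div_iff₀ hZpos]; exact hmass
  have hqpos : 0 < q := hw₀.trans_le hqw
  have hYZ : 2 * L₀ ≤ Y / Z := by rw [le_div_iff₀ hZpos]; exact hY
  have hY0 : 0 ≤ Y / (2 * Z) := by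
    have : 0 ≤ Y / Z := le_trans (by positivity) hYZ
    rw [div_nonneg_iff]; left
    exact ⟨by have := this; rwa [le_div_iff₀ hZpos, zero_mul] at this, by positivity⟩
  have hlogq : -L₀ ≤ Real.log q := by
    have := Real.log_le_log hw₀ hqw
    linarith
  have hkey : Y / (2 * Z) ≤ |Real.log q - -(Y / Z)| := by
    refine le_trans ?_ (le_abs_self _)
    have e : Y / (2 * Z) = Y / Z - Y / (2 * Z) := by field_simp; ring
    rw [sub_neg_eq_add]
    have : Y / (2 * Z) ≤ Y / Z - L₀ := by
      rw [e]
      have h2 : L₀ ≤ Y / (2 * Z) := by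
        rw [le_div_iff₀ (by positivity)]; nlinarith [hYZ, hZpos]
      linarith
    linarith
  have hG0 : 0 ≤ G := setIntegral_nonneg (measurableSet_zSlab P 0) fun x _ => by positivity
  -- `(Y/(2Z)) q ≤ 3 √(Z⁻¹ · 1024ρ² G)`
  have h1 : Y / (2 * Z) * q ≤ 3 * Real.sqrt (Z⁻¹ * (1024 * ρ ^ 2 * G)) := by
    have h := hkey.trans hN
    rw [le_div_iff₀ hqpos] at h
    refine h.trans (mul_le_mul_of_nonneg_left (Real.sqrt_le_sqrt ?_) (by norm_num))
    exact mul_le_mul_of_nonneg_left hPG (inv_nonneg.2 hZpos.le)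
  have h2 : Y / (2 * Z) * w₀ ≤ 3 * Real.sqrt (Z⁻¹ * (1024 * ρ ^ 2 * G)) :=
    (mul_le_mul_of_nonneg_left hqw hY0).trans h1
  -- square
  have h3 : (Y / (2 * Z) * w₀) ^ 2 ≤ 9 * (Z⁻¹ * (1024 * ρ ^ 2 * G)) := by
    have hl : 0 ≤ Y / (2 * Z) * w₀ := mul_nonneg hY0 hw₀.le
    have := pow_le_pow_left₀ hl h2 2
    rw [mul_pow (3 : ℝ), Real.sq_sqrt (by positivity)] at this
    linarith [this]
  -- rearrange
  have e : w₀ ^ 2 / (36864 * ρ ^ 2 * Z) * Y ^ 2 = (Z / (9216 * ρ ^ 2)) * (Y / (2 * Z) * w₀) ^ 2 := by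
    field_simp
    ring
  rw [e]
  calc Z / (9216 * ρ ^ 2) * (Y / (2 * Z) * w₀) ^ 2 ≤ Z / (9216 * ρ ^ 2) * (9 * (Z⁻¹ * (1024 * ρ ^ 2 * G))) :=
        mul_le_mul_of_nonneg_left h3 (by positivity)
    _ = G := by field_simp; ring

end LeiRenZhang2019

end Literature.Analysis.FluidPDE

end
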